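import Summits.BirchSwinnertonDyer.BirchSwinnertonDyer.Theorems.CyclotomicUntwistGammaLeadingTerm
import HarnessLib

/-!
# Route `CyclotomicUntwist`, crux K1 `PSRankOneLowerHalfAtThree`: VACUITY CENSUS, part I — the D3
# hypothesis structure `PSFiniteSlopeSelmerData` against the pen's split spec C2 IMC₃ / C3 READ
# (kernel certificates; no crux is closed)

Cell `pub/bsd-wall` (D-0145 line `route-BirchSwinnertonDyer-CyclotomicUntwist`), width seat
`bsd-line-cycu-p5` g0. THEOREMS ONLY (no definition, no named fact, no `sorry`); helper `--supports`
K1 = stmt-BirchSwinnertonDyer-21580 (bears equally on K2 = 21581). BSD is not proved by this file and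
nothing here is evidence for or against BSD: the theorems are about the TYPING of the route's
finite-slope road — what the hypothesis structure D3 (`Literature.NumberTheory.IwasawaTheory.
PSFiniteSlopeSelmerData W η α`, documented as junk-inhabitable: "the zero system is a datum …
consumers quantify over the datum") does and does not constrain once a child ITEM quantifies over it.
Part II (`CyclotomicUntwistFiniteSlopeLineHeightVacuity`) does the same for D2 `PSLineHeightData`.

* §1 **The tautological Selmer datum.** For every ball system `𝓛` that is additive of order `≤ ½`
  (which D1 `IsPSCyclotomicLFunctionOf W η α 𝓛` provides) the datum `D_𝓛 := ⟨𝓛, 0, r⟩` (generator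
  `:= 𝓛` ITSELF, declared shift `0`, any declared Selmer rank `r`) satisfies `D_𝓛.IsNormalisedFor 𝓛`
  (`v = [1]`, the Dirac unit of `Λ_𝓞`), `IsUnitMultipleOf`, `IsUnitMultipleOfAtCharacters`, the
  one-sided KATO₃(typed) / WAN₃(typed) shapes of the cell's closers (`𝓛 = 3^0 · ([1] ⋆ char)`,
  `char = 3^0 · ([1] ⋆ 𝓛)`), the control inequality for any `r ≤ ord_𝟙 𝓛` and the exact order for
  `r = ord_𝟙 𝓛`. CONSEQUENCE: a child of the shape C2 `∀ row ∀ (η α 𝓛), ∃ D : PSFiniteSlopeSelmerData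
  W η α, D.IsNormalisedFor 𝓛 ∧ (control)` is inhabited BY CONSTRUCTION — it carries no
  main-conjecture content; its only residue is a statement about `ord_𝟙 𝓛`, the ANALYTIC order of
  vanishing (on the route's rows `1 ≤ ord_𝟙 𝓛` is already a theorem, cycu-p2 g2).
* §2 **READ quantified over all normalised data is a statement about `𝓛` alone**: for every `D` with
  `D.IsNormalisedFor 𝓛`, `‖3^{-e} · D.leadingCoeffAtOne‖ = ‖lead_𝟙(𝓛)‖` (`e = D.pPowerShift`;
  cycu-p1 g2's SHIFT lemma) and `D.orderAtOne = ord_𝟙 𝓛`; hence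
  `(∀ D normalised for 𝓛, ‖3^{-e} · D.leadingCoeffAtOne‖ = X) ↔ ‖lead_𝟙(𝓛)‖ = X`. CONSEQUENCE:
  the spec's C3 READ `∀ D normalised, ‖3^{-e}·D.lc‖ = ‖κ_alg‖·‖S‖·‖ι(h)‖` is literally the `3`-adic
  leading-term formula `‖lead_𝟙(𝓛)‖ = ‖κ_alg‖·‖S‖·‖ι(h)‖` for the ANALYTIC function — the
  algebraic (Selmer) side is absent from it; and quantified `∃ D` it is inhabited like C2.

Typing consequence (memo CU-K1-SPLIT-VACUITY-v1.md, evidence on 21580/21581): with D3 as it stands,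
"IMC₃" cannot be an item — `∃ D` is free and `∀ D` speaks only of `𝓛`; the Selmer datum must be
TIED TO `W` (a D3′ whose predicate determines `charElt` up to `𝓗^×` from `W`) before C2/C3 can be
filed; until then K1 stays whole, as the pen ruled. [cite: Benois2014, §0.4 (ii) and Remark 1;
§4.2 Prop. 12] [cite: Pottharst2013, p. 1573] [cite: PerrinRiou1993AIF, Introduction]
-/

set_option autoImplicit false
-- single-conjunct summit: `Summit.BirchSwinnertonDyer.BirchSwinnertonDyer.…` repeats the name by design
set_option linter.dupNamespace false

noncomputable section

open scoped Classical

open WeierstrassCurve Literature.NumberTheory.EllipticCurves Literature.NumberTheory.IwasawaTheory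
  Literature.NumberTheory.IwasawaTheory.PSFiniteSlopeSelmerData
  Summit.BirchSwinnertonDyer.BirchSwinnertonDyer.Theorems.PSGammaConvolution
  Summit.BirchSwinnertonDyer.BirchSwinnertonDyer.Theorems.PSGammaLeadingTerm

namespace Summit.BirchSwinnertonDyer.BirchSwinnertonDyer.Theorems.CyclotomicUntwistFiniteSlopeSelmerDataVacuity

/-! ### §1 The tautological D3 datum: typed IMC₃ / KATO₃ / WAN₃ hypotheses with `∃ D` are inhabited -/

section SelmerDatum

variable {W : WeierstrassCurve ℚ} {η : DirichletCharacter ℂ_[3] (3 ^ 2)} {α : ℂ_[3]}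
  {𝓛 : (n : ℕ) → ZMod (3 ^ n) → ℂ_[3]}

/-- **The tautological datum.** For ball values `𝓛` additive of order `≤ ½` and any `r : ℕ`, the
D3 datum with generator `charElt := 𝓛`, declared shift `0` and declared Selmer rank `r` exists and is
NORMALISED FOR `𝓛` (`char = 3^0 · ([1] ⋆ 𝓛)`, `[1]` the Dirac unit of `Λ_𝓞`). Nothing in
`PSFiniteSlopeSelmerData W η α` ties `charElt` to a Selmer group of `W`. [cite: Benois2014, §0.4 (ii) and Remark 1] -/
theorem exists_selfDatum (h𝓛 : IsGammaDistribution 3 𝓛) (h𝓛' : HasGrowthOrder 3 (1 / 2) 𝓛) (r : ℕ) :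
    ∃ D : PSFiniteSlopeSelmerData W η α,
      D.charElt = 𝓛 ∧ D.pPowerShift = 0 ∧ D.selmerRank = r ∧ D.IsNormalisedFor 𝓛 := by
  refine ⟨⟨𝓛, h𝓛, h𝓛', 0, r⟩, rfl, rfl, rfl, gammaDirac 3, isIwasawaUnit_gammaDirac, fun n s ↦ ?_⟩
  rw [gammaConv_gammaDirac_left]
  simp

/-- **C2-shape is inhabited**: `∃ D, D.IsNormalisedFor 𝓛` holds for every additive order-`≤ ½`
system `𝓛`, in particular for every D1 function. [cite: Benois2014, §0.4 (ii) and Remark 1] -/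
theorem exists_isNormalisedFor (h𝓛 : IsGammaDistribution 3 𝓛) (h𝓛' : HasGrowthOrder 3 (1 / 2) 𝓛) :
    ∃ D : PSFiniteSlopeSelmerData W η α, D.IsNormalisedFor 𝓛 := by
  obtain ⟨D, -, -, -, hD⟩ := exists_selfDatum (W := W) (η := η) (α := α) h𝓛 h𝓛' 0
  exact ⟨D, hD⟩

/-- The same from the D1 predicate: every principal-series cyclotomic `3`-adic `L`-function admits a
normalised D3 datum (the tautological one). [cite: Benois2014, §0.4 (ii) and Remark 1] -/
theorem exists_isNormalisedFor_of_isPSCyclotomicLFunctionOf (h : IsPSCyclotomicLFunctionOf W η α 𝓛) :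
    ∃ D : PSFiniteSlopeSelmerData W η α, D.IsNormalisedFor 𝓛 :=
  exists_isNormalisedFor h.isGammaDistribution_and_hasGrowthOrder.1
    h.isGammaDistribution_and_hasGrowthOrder.2

/-- **C2-shape with the control inequality is inhabited** whenever the declared rank does not exceed
the ANALYTIC order of vanishing: `∃ D, D.IsNormalisedFor 𝓛 ∧ D.HasControlInequality ∧ D.selmerRank = r`
for every `r ≤ ord_𝟙 𝓛`. (On the route's rows `1 ≤ ord_𝟙 𝓛` is a theorem — `c₀(𝓛) = 0` from
`r_an = 1`, cycu-p2 g2 — so the rank-one control shape is free.) [cite: Benois2014, §4.2 Prop. 12] -/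
theorem exists_isNormalisedFor_hasControlInequality (h𝓛 : IsGammaDistribution 3 𝓛)
    (h𝓛' : HasGrowthOrder 3 (1 / 2) 𝓛) {r : ℕ} (hr : (r : ℕ∞) ≤ gammaOrderAtOne 3 𝓛) :
    ∃ D : PSFiniteSlopeSelmerData W η α,
      D.IsNormalisedFor 𝓛 ∧ D.HasControlInequality ∧ D.selmerRank = r ∧ D.pPowerShift = 0 := by
  obtain ⟨D, hchar, he, hrk, hD⟩ := exists_selfDatum (W := W) (η := η) (α := α) h𝓛 h𝓛' r
  refine ⟨D, hD, ?_, hrk, he⟩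
  rw [hasControlInequality_iff, hrk, orderAtOne, hchar]
  exact hr

/-- **C2-shape with EXACT order is inhabited** when the declared rank equals the analytic order:
`∃ D, D.IsNormalisedFor 𝓛 ∧ D.HasExactOrderAtOne ∧ D.selmerRank = r` whenever `ord_𝟙 𝓛 = r`.
[cite: Benois2014, §4.2 (Definition; Prop. 12)] -/
theorem exists_isNormalisedFor_hasExactOrderAtOne (h𝓛 : IsGammaDistribution 3 𝓛)
    (h𝓛' : HasGrowthOrder 3 (1 / 2) 𝓛) {r : ℕ} (hr : gammaOrderAtOne 3 𝓛 = r) :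
    ∃ D : PSFiniteSlopeSelmerData W η α,
      D.IsNormalisedFor 𝓛 ∧ D.HasExactOrderAtOne ∧ D.HasControlInequality ∧ D.selmerRank = r ∧
        D.pPowerShift = 0 := by
  obtain ⟨D, hchar, he, hrk, hD⟩ := exists_selfDatum (W := W) (η := η) (α := α) h𝓛 h𝓛' r
  have hex : D.HasExactOrderAtOne := by
    rw [hasExactOrderAtOne_iff, hrk, orderAtOne, hchar, hr]
  exact ⟨D, hD, hex, hex.hasControlInequality, hrk, he⟩

/-- **The identity-of-ideals shape `IsUnitMultipleOf` is inhabited** (tautological datum, `u = [1]`).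
[cite: Benois2014, §0.4 (ii) and Remark 1] -/
theorem exists_isUnitMultipleOf (h𝓛 : IsGammaDistribution 3 𝓛) (h𝓛' : HasGrowthOrder 3 (1 / 2) 𝓛) :
    ∃ D : PSFiniteSlopeSelmerData W η α, D.IsUnitMultipleOf 𝓛 := by
  obtain ⟨D, hD⟩ := exists_isNormalisedFor (W := W) (η := η) (α := α) h𝓛 h𝓛'
  exact ⟨D, hD.isUnitMultipleOf⟩

/-- **The character-value shape `IsUnitMultipleOfAtCharacters` is inhabited** (tautological datum,
`u = [1]`, `[1](ξ) · 𝓛(ξ) = ([1] ⋆ 𝓛)(ξ) = 𝓛(ξ)` by cycu-p1 g2's `gammaCharValue_gammaConv`).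
[cite: Benois2014, §0.4 (ii) and Remark 1] [cite: Bellaiche2021, Thm. 6.2.13] -/
theorem exists_isUnitMultipleOfAtCharacters (h𝓛 : IsGammaDistribution 3 𝓛)
    (h𝓛' : HasGrowthOrder 3 (1 / 2) 𝓛) :
    ∃ D : PSFiniteSlopeSelmerData W η α, D.IsUnitMultipleOfAtCharacters 𝓛 := by
  obtain ⟨D, hchar, -, -, -⟩ := exists_selfDatum (W := W) (η := η) (α := α) h𝓛 h𝓛' 0
  refine ⟨D, gammaDirac 3, isIwasawaUnit_gammaDirac.isIwasawaUnitUpToPPower, fun m ξ ↦ ?_⟩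
  rw [hchar, ← gammaCharValue_gammaConv, gammaConv_gammaDirac_left]

/-- **KATO₃(typed) with control is inhabited** (the hypothesis shape of cycu-p3 g2's
`psRankOneUpperHalfAtThree_of_katoTyped`: `∃ a ∈ Λ_𝓞, e', D` with `𝓛 = 3^{e'} · (a ⋆ D.charElt)`,
`D.HasControlInequality`, `D.selmerRank = 1`) — by `a = [1]`, `e' = 0`, `D = D_𝓛`, as soon as
`1 ≤ ord_𝟙 𝓛` (a theorem on the rows). So the typed one-sided divisibility, existentially quantified
over the datum, carries no Euler-system content. [cite: Kato2004Asterisque, Thm. 12.5] [cite: Benois2014, §4.2 Prop. 12] -/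
theorem exists_katoTypedShape (h𝓛 : IsGammaDistribution 3 𝓛) (h𝓛' : HasGrowthOrder 3 (1 / 2) 𝓛)
    (hord : (1 : ℕ∞) ≤ gammaOrderAtOne 3 𝓛) :
    ∃ (a : (n : ℕ) → ZMod (3 ^ n) → ℂ_[3]) (e' : ℤ) (D : PSFiniteSlopeSelmerData W η α),
      IsGammaDistribution 3 a ∧ IsIwasawaIntegral 3 a ∧
      (∀ (n : ℕ) (s : ZMod (3 ^ n)), 𝓛 n s = (3 : ℂ_[3]) ^ e' * gammaConv 3 a D.charElt n s) ∧
      D.HasControlInequality ∧ D.selmerRank = 1 := by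
  obtain ⟨D, hchar, -, hrk, -⟩ := exists_selfDatum (W := W) (η := η) (α := α) h𝓛 h𝓛' 1
  refine ⟨gammaDirac 3, 0, D, isGammaDistribution_gammaDirac, isIwasawaUnit_gammaDirac.2.1,
    fun n s ↦ ?_, ?_, hrk⟩
  · rw [hchar, gammaConv_gammaDirac_left]
    simp
  · rw [hasControlInequality_iff, hrk, orderAtOne, hchar]
    exact_mod_cast hord

/-- **WAN₃(typed) with exact order is inhabited** (the converse one-sided shape:
`∃ b ∈ Λ_𝓞, e, D` with `D.charElt = 3^e · (b ⋆ 𝓛)`, `D.HasExactOrderAtOne`, `D.selmerRank = r`) —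
by `b = [1]`, `e = 0`, `D = D_𝓛`, whenever `ord_𝟙 𝓛 = r`. [cite: Benois2014, §0.4 (ii) and Remark 1] -/
theorem exists_wanTypedShape (h𝓛 : IsGammaDistribution 3 𝓛) (h𝓛' : HasGrowthOrder 3 (1 / 2) 𝓛)
    {r : ℕ} (hr : gammaOrderAtOne 3 𝓛 = r) :
    ∃ (b : (n : ℕ) → ZMod (3 ^ n) → ℂ_[3]) (e : ℤ) (D : PSFiniteSlopeSelmerData W η α),
      IsGammaDistribution 3 b ∧ IsIwasawaIntegral 3 b ∧
      (∀ (n : ℕ) (s : ZMod (3 ^ n)), D.charElt n s = (3 : ℂ_[3]) ^ e * gammaConv 3 b 𝓛 n s) ∧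
      D.HasExactOrderAtOne ∧ D.selmerRank = r := by
  obtain ⟨D, hchar, -, hrk, -⟩ := exists_selfDatum (W := W) (η := η) (α := α) h𝓛 h𝓛' r
  refine ⟨gammaDirac 3, 0, D, isGammaDistribution_gammaDirac, isIwasawaUnit_gammaDirac.2.1,
    fun n s ↦ ?_, ?_, hrk⟩
  · rw [hchar, gammaConv_gammaDirac_left]
    simp
  · rw [hasExactOrderAtOne_iff, hrk, orderAtOne, hchar, hr]

end SelmerDatum

/-! ### §2 READ quantified over all normalised data is a statement about `𝓛` alone -/

section Read

variable {W : WeierstrassCurve ℚ} {η : DirichletCharacter ℂ_[3] (3 ^ 2)} {α : ℂ_[3]}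
  {𝓛 : (n : ℕ) → ZMod (3 ^ n) → ℂ_[3]}

/-- **The shifted algebraic leading term of ANY normalised datum has the norm of the analytic one**:
`D.IsNormalisedFor 𝓛 ⇒ ‖3^{-e} · D.leadingCoeffAtOne‖ = ‖lead_𝟙(𝓛)‖`, `e = D.pPowerShift`
(cycu-p1 g2's SHIFT lemma `norm_leadingCoeffAtOne_of_isNormalisedFor`, rescaled).
[cite: Benois2014, §0.4 Remark 1] -/
theorem norm_shiftedLeadingCoeff_of_isNormalisedFor (D : PSFiniteSlopeSelmerData W η α)
    (h : D.IsNormalisedFor 𝓛) (h𝓛 : IsGammaDistribution 3 𝓛) (h𝓛' : HasGrowthOrder 3 (1 / 2) 𝓛) :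
    ‖(3 : ℂ_[3]) ^ (-D.pPowerShift) * D.leadingCoeffAtOne‖ = ‖gammaLeadingCoeff 3 𝓛‖ := by
  -- `‖3^k‖ = 3^{-k}` in `ℂ₃` (as in cycu-p3 g2's `norm_three_zpow`; inlined, not restated)
  have h3 : ‖(3 : ℂ_[3])‖ = (3 : ℝ)⁻¹ := by
    have h : ‖((3 : ℕ) : ℂ_[3])‖ = ((3 : ℕ) : ℝ)⁻¹ := by
      rw [← map_natCast (algebraMap ℚ_[3] ℂ_[3]) 3, norm_algebraMap', Padic.norm_p]
    simpa using h
  have hz : ‖(3 : ℂ_[3]) ^ (-D.pPowerShift)‖ = (3 : ℝ) ^ D.pPowerShift := by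
    rw [norm_zpow, h3, inv_zpow', neg_neg]
  rw [norm_mul, hz, norm_leadingCoeffAtOne_of_isNormalisedFor D h h𝓛 h𝓛', ← mul_assoc,
    ← zpow_add₀ (by norm_num : (3 : ℝ) ≠ 0), add_neg_cancel, zpow_zero, one_mul]

/-- **READ-over-all-normalised-data ⟺ the same identity for `𝓛`**: for any real `X`,
`(∀ D, D.IsNormalisedFor 𝓛 → ‖3^{-e} · D.leadingCoeffAtOne‖ = X) ↔ ‖lead_𝟙(𝓛)‖ = X`
(`→`: the tautological datum of §1; `←`: the SHIFT lemma). With `X = ‖κ_alg‖ · ‖#Ш ∏c/#tors²‖ · ‖ι(h)‖`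
this is the spec's C3: a `3`-adic leading-term formula for the ANALYTIC function, the Selmer side
absent. [cite: Benois2014, §0.4 Remark 1] [cite: PerrinRiou1993AIF, Introduction] -/
theorem forall_isNormalisedFor_norm_shiftedLeadingCoeff_eq_iff (h𝓛 : IsGammaDistribution 3 𝓛)
    (h𝓛' : HasGrowthOrder 3 (1 / 2) 𝓛) (X : ℝ) :
    (∀ D : PSFiniteSlopeSelmerData W η α, D.IsNormalisedFor 𝓛 →
        ‖(3 : ℂ_[3]) ^ (-D.pPowerShift) * D.leadingCoeffAtOne‖ = X) ↔
      ‖gammaLeadingCoeff 3 𝓛‖ = X := by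
  constructor
  · intro H
    obtain ⟨D, -, -, -, hD⟩ := exists_selfDatum (W := W) (η := η) (α := α) h𝓛 h𝓛' 0
    rw [← norm_shiftedLeadingCoeff_of_isNormalisedFor D hD h𝓛 h𝓛']
    exact H D hD
  · intro hX D hD
    rw [norm_shiftedLeadingCoeff_of_isNormalisedFor D hD h𝓛 h𝓛', hX]

/-- **The order of vanishing of ANY normalised datum is the analytic one**, and conversely every value
of `ord_𝟙 𝓛` is realised: `(∀ D, D.IsNormalisedFor 𝓛 → D.orderAtOne = o) ↔ ord_𝟙 𝓛 = o`.
[cite: Benois2014, §0.4 Remark 1] -/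
theorem forall_isNormalisedFor_orderAtOne_eq_iff (h𝓛 : IsGammaDistribution 3 𝓛)
    (h𝓛' : HasGrowthOrder 3 (1 / 2) 𝓛) (o : ℕ∞) :
    (∀ D : PSFiniteSlopeSelmerData W η α, D.IsNormalisedFor 𝓛 → D.orderAtOne = o) ↔
      gammaOrderAtOne 3 𝓛 = o := by
  constructor
  · intro H
    obtain ⟨D, -, -, -, hD⟩ := exists_selfDatum (W := W) (η := η) (α := α) h𝓛 h𝓛' 0
    rw [← orderAtOne_eq_of_isNormalisedFor D hD h𝓛 h𝓛']
    exact H D hD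
  · intro ho D hD
    rw [orderAtOne_eq_of_isNormalisedFor D hD h𝓛 h𝓛', ho]

end Read

end Summit.BirchSwinnertonDyer.BirchSwinnertonDyer.Theorems.CyclotomicUntwistFiniteSlopeSelmerDataVacuity

end
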